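import Summits.QuantumFields.BalabanUV.Beta.EriceRemainderEnclosureHistoryAutonomyComparisonAgeCompositionShiftMonotoneFading
import Summits.QuantumFields.BalabanUV.Beta.EriceRemainderEnclosureHistoryAutonomyComparisonAgeCompositionDecayHorizon

/-!
# EriceRemainderEnclosureHistoryAutonomyComparisonAgeCompositionFadingEveryDamping — (E111l) route (N), first order: EVERY FADING PROFILE, EVERY RANGE, EVERY
# DAMPING.  (E111k) `renewal_nonneg_of_shift_monotone` needs of the kernel ONLY: non-negative entries vanishing from the lag `K` on, first entry `≤ 1`, and the
# shift domination of ENTRIES across pins, `KA 1 m (l+1) ≤ KA 1 (m+1) l` — «the pin one deeper reads every common target at least as strongly».  For the route-(N)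
# kernel WITH DAMPING, `KL k m l = [0<k<K, l<k]·(L_kh_{m+k}³∕2)·Π_{t ∈ [m+1+l, m+k]} g_t`, the two entries at the common target `m+2+l` are
# `Σ_{k ≥ l+2} (L_kh_{m+k}³∕2)·Π_{[m+2+l, m+k]} g` and `Σ_{k' ≥ l+1} (L_{k'}h_{m+1+k'}³∕2)·Π_{[m+2+l, m+1+k']} g`: under `k' = k − 1` the damping products COINCIDE
# (same target, same top scale `m+k`), so the domination holds termwise exactly when `L_k ≤ L_{k−1}` (`k ≥ 2`) — for EVERY damping `0 < g ≤ 1`, not only the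
# self-consistent class (**`flow_shift_monotone_of_fading_damped`**).  Hence **`flow_nonneg_fading`**: `B` an isotone memory with floor dominating a profile `L ≥ 0`
# (`L_0 = 0`) that is FADING from age one on (`L_{k+1} ≤ L_k`, `k ≥ 1`), of ANY range `K`; `h` a box solution; ANY damping `0 < g ≤ 1`; ANY horizon; every admissible
# excess: `0 ≤ ε ≤ e` at every pin.  This is the first-order census counterpart of the nonlinear comparison (E60a) for fading memories, and it REMOVES the range
# bound of (E90d) (`K ≤ 53`) on the fading class; (E111k) `flow_nonneg_fading_undamped` is its `g ≡ 1` case (kept: it needs one import less).  In matrix form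
# (README `HOME/b2b-balaban-beta-d4-p2/g92/README.md` §5; g62's remark on the fading class made a theorem): with `U` the summation matrix of the excess cone
# (`e = Uδ`, `δ ≥ 0`), `U⁻¹(I + K)` is an upper-triangular Z-matrix — hence inverse-positive — iff the entry domination holds and `KA 1 m 0 ≤ 1`.

Cell `pub-balaban`, β-function sub-cell, BINDER row D4 «RemainderConst leaves for Bałaban's split» (`HOME/BINDER-OWNERS.md`; owner lineage `b2b-balaban-beta-an4`;
this file by co-owner #2 lineage `b2b-balaban-beta-d4-p2`, generation 92), β-FLOW TEAM duty (1), FREEZE (0) honoured (def-free; nothing restated).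

HONEST FRAMING (page 1, verbatim and binding).  *"Discharging BetaPertH makes Bałaban's UV stability UNCONDITIONAL — a real constructive-QFT result; it is
NOT the continuum limit and NOT the Clay problem."*  THIS FILE DISCHARGES NOTHING OF THE KIND.  Elementary real algebra ∕ real analysis about ABSTRACT
functionals on a box ]0,γ]^ℕ with displayed floors, profiles and signs, and the FIRST-ORDER renewal objects of route (N) built from them — hypotheses of a
census, not facts; the form, signs, ages and moments of Bałaban's (1.22) limit functional (in particular whether its age profile fades) are NOT PRINTED ([I] p. 298;
GAPS G-t4-U2-1∕-2) and NOT asserted.  Row D4 class UNCHANGED (critical-path width 0; instance 0∕1; D4 DISCHARGE NO DATE).  HONEST DEPENDENCY: continuum YM on T⁴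
⇐ BetaPertH ∧ nine spine estimates (0/9 proved); BetaPertH ⇐ (D1) ∧ (D4) ∧ CAP+tail; G-an2-4 gates asym, D1 and NE2/3/4.

THE POINT (README `HOME/b2b-balaban-beta-d4-p2/g92/README.md` §5).  Uses (E111k) `renewal_nonneg_of_shift_monotone`, (E98c) `aggregate_one_eq`, (E91) `lagZero_le`, (E94)
`kernel_entry_le`, (E86a) `aggregate_eq_zero_of_horizon` BY NAME.  NOT CLAIMED: profiles that rise somewhere after age one; anything nonlinear; anything printed —
NOT B12 Thm 2, NOT BetaPertH, NOT continuum, NOT Clay.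

WHAT IS PROVED ([folklore]; 0 `def`, 0 sorry).  §1 `entry_shift_le`, **`flow_shift_monotone_of_fading_damped`**.  §2 **`flow_nonneg_fading`**.
-/
noncomputable section
open Finset

namespace Summit.QuantumFields.BalabanUV.Beta.EriceRemainderEnclosureHistoryAutonomyComparisonAgeCompositionFadingEveryDamping

open Literature.MathematicalPhysics.QuantumFieldTheory.Balaban1983to89
open Literature.MathematicalPhysics.QuantumFieldTheory.Balaban1983to89.T4BetaStationary
open Literature.MathematicalPhysics.QuantumFieldTheory.Balaban1983to89.T4BetaFlowWellPosed
open Summit.QuantumFields.BalabanUV.Beta.EriceRemainderEnclosureHistoryAutonomyComparisonAgeCompositionTwoAgesOldRead (lagZero_le)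
open Summit.QuantumFields.BalabanUV.Beta.EriceRemainderEnclosureHistoryAutonomyComparisonAgeCompositionYoungestTailSumFlow (kernel_entry_le)
open Summit.QuantumFields.BalabanUV.Beta.EriceRemainderEnclosureHistoryAutonomyComparisonAgeCompositionUpwardChainFlow (aggregate_one_eq)
open Summit.QuantumFields.BalabanUV.Beta.EriceRemainderEnclosureHistoryAutonomyComparisonAgeCompositionDecayHorizon (aggregate_eq_zero_of_horizon)
open Summit.QuantumFields.BalabanUV.Beta.EriceRemainderEnclosureHistoryAutonomyComparisonAgeCompositionShiftMonotoneFading (renewal_nonneg_of_shift_monotone)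

variable {B : (ℕ → ℝ) → ℝ} {γ b gIR : ℝ} {L : ℕ → ℝ} {K : ℕ} {h g : ℕ → ℝ} {KL : ℕ → ℕ → ℕ → ℝ}

/-! ## §1 Fading makes the damped kernel's entries shift-dominated -/

/-- **ONE ENTRY, ONE AGE DOWN.**  For the damped lone kernels of route (N), `h > 0`, `0 < g ≤ 1`, `L ≥ 0` fading from age one on: the entry of age `k+1` at pin `n`,
lag `l+1` is at most the entry of age `k` at pin `n+1`, lag `l` — both read the target `n+2+l` with the SAME damping product `Π_{[n+2+l, n+k+1]} g`, and
`L_{k+1}h_{n+k+1}³ ≤ L_kh_{n+1+k}³`. [folklore] -/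
theorem entry_shift_le (hL : ∀ k, 0 ≤ L k) (hh : SeqBox γ h) (hg : ∀ t, 0 < g t ∧ g t ≤ 1) (hfade : ∀ k, 1 ≤ k → L (k + 1) ≤ L k)
    (hKL : ∀ k n l, KL k n l = if 0 < k ∧ k < K ∧ l < k then L k * h (n + k) ^ 3 / 2 * ∏ t ∈ Ico (n + 1 + l) (n + k + 1), g t else 0)
    (k n l : ℕ) : KL (k + 1) n (l + 1) ≤ KL k (n + 1) l := by
  have hpos : ∀ m, 0 < h m := fun m => (hh m).1
  have e1 := hKL (k + 1) n (l + 1)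
  have e2 := hKL k (n + 1) l
  rw [e1, e2]
  split_ifs with h1 h2 h2
  · have hk : 1 ≤ k := by omega
    rw [show n + (k + 1) = n + 1 + k by omega, show n + 1 + (l + 1) = n + 1 + 1 + l by omega]
    have hX : 0 ≤ h (n + 1 + k) ^ 3 / 2 * ∏ t ∈ Ico (n + 1 + 1 + l) (n + 1 + k + 1), g t :=
      mul_nonneg (by have := hpos (n + 1 + k); positivity) (prod_nonneg fun t _ => (hg t).1.le)
    calc L (k + 1) * h (n + 1 + k) ^ 3 / 2 * ∏ t ∈ Ico (n + 1 + 1 + l) (n + 1 + k + 1), g t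
        = L (k + 1) * (h (n + 1 + k) ^ 3 / 2 * ∏ t ∈ Ico (n + 1 + 1 + l) (n + 1 + k + 1), g t) := by ring
      _ ≤ L k * (h (n + 1 + k) ^ 3 / 2 * ∏ t ∈ Ico (n + 1 + 1 + l) (n + 1 + k + 1), g t) := mul_le_mul_of_nonneg_right (hfade k hk) hX
      _ = L k * h (n + 1 + k) ^ 3 / 2 * ∏ t ∈ Ico (n + 1 + 1 + l) (n + 1 + k + 1), g t := by ring
  · exact absurd (⟨by omega, by omega, by omega⟩ : 0 < k ∧ k < K ∧ l < k) h2
  · exact mul_nonneg (by have := hpos (n + 1 + k); have := hL k; positivity) (prod_nonneg fun t _ => (hg t).1.le)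
  · exact le_rfl

/-- **A FADING PROFILE MAKES THE DAMPED KERNEL SHIFT-MONOTONE.**  Aggregates `KA 1 = Σ_{1 ≤ k < K} KL k` of the damped lone kernels, `L` fading from age one on,
ANY damping `0 < g ≤ 1`: `KA 1 n (l+1) ≤ KA 1 (n+1) l` for all `n, l` (sum of `entry_shift_le` after the index shift `k ↦ k−1`; the age-`1` entry at lag `l+1`
vanishes, the age-`(K−1)` entry at pin `n+1` is dropped). [folklore] -/
theorem flow_shift_monotone_of_fading_damped (hL : ∀ k, 0 ≤ L k) (hh : SeqBox γ h) (hg : ∀ t, 0 < g t ∧ g t ≤ 1)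
    (hfade : ∀ k, 1 ≤ k → L (k + 1) ≤ L k)
    (hKL : ∀ k n l, KL k n l = if 0 < k ∧ k < K ∧ l < k then L k * h (n + k) ^ 3 / 2 * ∏ t ∈ Ico (n + 1 + l) (n + k + 1), g t else 0)
    {KA : ℕ → ℕ → ℕ → ℝ} (hKA : ∀ i m l, KA i m l = KL i m l + KA (i + 1) m l) (hKAtop : ∀ m l, KA K m l = 0) (n l : ℕ) :
    KA 1 n (l + 1) ≤ KA 1 (n + 1) l := by
  have h0 : ∀ q i, 0 ≤ KL q n i ∧ 0 ≤ KL q (n + 1) i := fun q i =>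
    ⟨(kernel_entry_le hL hh hg hKL q n i).1, (kernel_entry_le hL hh hg hKL q (n + 1) i).1⟩
  have hKL0 : ∀ m i, KL 0 m i = 0 := fun m i => by rw [hKL, if_neg (fun hc => by omega)]
  -- both aggregates as sums over `range K`
  have hsum : ∀ m i, KA 1 m i = ∑ k ∈ range K, KL k m i := by
    intro m i
    rcases Nat.eq_zero_or_pos K with hK0 | hKpos
    · subst hK0; rw [sum_range_zero]
      have := hKA 0 m i; rw [hKAtop, hKL0, zero_add] at this; simpa using this.symm
    · rw [aggregate_one_eq hKL hKA hKAtop, range_eq_Ico, sum_eq_sum_Ico_succ_bot hKpos, hKL0, zero_add]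
  rw [hsum, hsum]
  rcases Nat.eq_zero_or_pos K with hK0 | hKpos
  · subst hK0; simp
  obtain ⟨K', rfl⟩ : ∃ K', K = K' + 1 := ⟨K - 1, by omega⟩
  rw [sum_range_succ' (fun k => KL k n (l + 1)), hKL0, add_zero, sum_range_succ]
  have hlast : 0 ≤ KL K' (n + 1) l := (h0 K' l).2
  have hmain : ∑ k ∈ range K', KL (k + 1) n (l + 1) ≤ ∑ k ∈ range K', KL k (n + 1) l :=
    sum_le_sum fun k _ => entry_shift_le hL hh hg hfade hKL k n l
  linarith

/-! ## §2 Every fading profile, every range, every damping -/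

/-- **EVERY FADING PROFILE, EVERY RANGE, EVERY DAMPING — THE FIRST-ORDER END.**  `B` an isotone memory with floor `b > 0` dominating the profile `L ≥ 0` on the ages
`< K` (`L_0 = 0`), FADING from age one on (`L (k+1) ≤ L k` for `k ≥ 1`), `K` ARBITRARY; `h` a box solution; ANY damping `0 < g ≤ 1`; the damped lone kernels
`KL`, aggregates `KA`, reads `RA`; `e ≥ 0` non-increasing, ANY horizon `N`; `ε` the zero-tailed solution of `ε = e − RA 1 ε`.  THEN `0 ≤ ε ≤ e` at every pin —
(E111k) `renewal_nonneg_of_shift_monotone` with §1 and (E91) `lagZero_le` (`KA 1 m 0 ≤ Σ_k L_kh_{m+k}³∕2 ≤ 1∕(m+1)`). [folklore] -/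
theorem flow_nonneg_fading (hmono : ∀ u v : ℕ → ℝ, SeqBox γ u → SeqBox γ v → (∀ j, u j ≤ v j) → B u ≤ B v)
    (hL : ∀ k, 0 ≤ L k) (hb : 0 < b) (hlo : ∀ u, SeqBox γ u → b ≤ B u) (hdom : ∀ u, SeqBox γ u → ∑ k ∈ range K, L k * u k ≤ B u)
    (hh : SeqBox γ h) (hf : MemFlow B gIR h) (hg : ∀ t, 0 < g t ∧ g t ≤ 1) (hL0 : L 0 = 0) (hfade : ∀ k, 1 ≤ k → L (k + 1) ≤ L k)
    {N : ℕ} (hKL : ∀ k n l, KL k n l = if 0 < k ∧ k < K ∧ l < k then L k * h (n + k) ^ 3 / 2 * ∏ t ∈ Ico (n + 1 + l) (n + k + 1), g t else 0)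
    {KA : ℕ → ℕ → ℕ → ℝ} {RA : ℕ → (ℕ → ℝ) → ℕ → ℝ}
    (hRA : ∀ i v m, RA i v m = ∑ l ∈ range K, KA i m l * v (m + 1 + l))
    (hKA : ∀ i m l, KA i m l = KL i m l + KA (i + 1) m l) (hKAtop : ∀ m l, KA K m l = 0)
    {e ε : ℕ → ℝ} (he0 : ∀ m, 0 ≤ e m) (hea : ∀ m, e (m + 1) ≤ e m)
    (hεt : ∀ m, N < m → ε m = 0) (hεrec : ∀ m, ε m = e m - RA 1 ε m) : ∀ m, 0 ≤ ε m ∧ ε m ≤ e m := by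
  have hpos : ∀ n, 0 < h n := fun n => (hh n).1
  have hKL0 : ∀ m i, KL 0 m i = 0 := fun m i => by rw [hKL, if_neg (fun hc => by omega)]
  have hsum : ∀ m i, KA 1 m i = ∑ k ∈ range K, KL k m i := by
    intro m i
    rcases Nat.eq_zero_or_pos K with hK0 | hKpos
    · subst hK0; rw [sum_range_zero]
      have := hKA 0 m i; rw [hKAtop, hKL0, zero_add] at this; simpa using this.symm
    · rw [aggregate_one_eq hKL hKA hKAtop, range_eq_Ico, sum_eq_sum_Ico_succ_bot hKpos, hKL0, zero_add]
  have hA0 : ∀ m l, 0 ≤ KA 1 m l := fun m l => by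
    rw [hsum]; exact sum_nonneg fun k _ => (kernel_entry_le hL hh hg hKL k m l).1
  have htop : ∀ m l, K ≤ l → KA 1 m l = 0 := fun m l hl =>
    aggregate_eq_zero_of_horizon hKA hKAtop (fun i m l hl => by rw [hKL, if_neg (fun hc => by omega)])
      (fun i m l hi => by rw [hKL, if_neg (fun hc => by omega)]) 1 m l hl
  have hA1 : ∀ m, KA 1 m 0 ≤ 1 := by
    intro m
    have hF := lagZero_le hmono hL hb hlo hdom hh hf hL0 m
    have h1 : KA 1 m 0 ≤ ∑ k ∈ range K, L k * h (m + k) ^ 3 / 2 := by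
      rw [hsum]
      refine sum_le_sum fun k _ => ((kernel_entry_le hL hh hg hKL k m 0).2).trans ?_
      split_ifs
      · exact le_rfl
      · have := hL k; have := hpos (m + k); positivity
    have h2 : 1 / ((m : ℝ) + 1) ≤ 1 := by
      rw [div_le_one (by positivity)]; have : (0 : ℝ) ≤ m := Nat.cast_nonneg m; linarith
    linarith
  exact renewal_nonneg_of_shift_monotone (Kw := K) (A := fun n l => KA 1 n l) (R := RA 1) hA0 htop hA1
    (fun n l => flow_shift_monotone_of_fading_damped hL hh hg hfade hKL hKA hKAtop n l) (hRA 1) he0 hea hεt hεrec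

end Summit.QuantumFields.BalabanUV.Beta.EriceRemainderEnclosureHistoryAutonomyComparisonAgeCompositionFadingEveryDamping

end
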